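import Mathlib
import Summits.NavierStokesRegularity.NavierStokesRegularity.Theorems.EulerZoomLiouvillePowerGaugeEulerLiouvilleDiscreteClockTools
import Summits.NavierStokesRegularity.NavierStokesRegularity.Theorems.EulerZoomLiouvillePowerGaugeEulerLiouvillePastSymmetric
import HarnessLib

/-!
# DISCRETE CLOCKS: OFF-RATE discretely self-similar members are trivial when FAST, SLOW, or of locally bounded energy with `g < 2/5`,
# and ALL of them at the endpoint `ρ = ½` (crux `EulerZoomLiouville.PowerGaugeEulerLiouville` = stmt-NavierStokesRegularity-19832;
# line `logtime-breathers` of ns-idea-11 — the DSS-ification of its power-clock chapter T4; PROFILE-FREE, WEAK class)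

Route `EulerZoomLiouville` (NavierStokesRegularity); width seat ns-ezl-w4 g2; sequel of `…DiscreteBreather`.  A POWER CLOCK about the final time,
`u(τ, y) = (−τ)^{g−1} W((−τ)^{−g} y)`, is invariant under Euler's scalings `(τ, y, u) ↦ (Tτ, T^{g}y, T^{g−1}u)` for ALL `T > 0`.  A member is a
DISCRETE CLOCK of rate `g` if it is invariant under ONE of them: for some `T > 1`,

> `u(τ, y) = T^{1−g} · u(Tτ, T^{g} y)` for all `τ < 0` and all `y`

— discretely self-similar about the space–time origin with time factor `T` and space factor `L = T^{g}`.  The tree's DSS strata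
(`u(τ,y) = l^{1+ρ} u(l^{2+ρ}τ, l y)`) are the CLASS RATE `g = 1/(2+ρ)` (`T = l^{2+ρ}`); every other rate was uncovered.  No profile, no regularity:
between the times `τ` and `Tτ` the member is arbitrary.  Iterating (`DiscreteClock.iterate`: `u(τ, y) = T^{(1−g)n} u(Tⁿτ, T^{gn} y)`, file
`…DiscreteClockTools`), the ball energies along the orbit are rescalings of one another, and gauge arithmetic ALONG THE ORBIT (the ball lemmas
`DiscreteClock.lintegral_ball_slice_eq_zero_of_fast/slow` of the tools file) kills exactly as for the continuous clocks
(`PastShape.…pastFastPowerClock` / `…slowPowerClock`, `PowerClock.…finiteEnergySlowClock`):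

* FAST `g > ½ − ρ/5` (`0 ≤ ρ ≤ ½`): the `A`-gauge at the time `Tⁿτ` on the ball of radius `K T^{n·max(g,½)}` gives
  `∫_{B_R}|u(τ)|² ≤ c K^{1−2ρ} T^{n e}`, `e = 2 − 5g + max(g,½)(1−2ρ) < 0`, so every slice is zero (`ae_eq_zero_of_gauge_of_fast`);
* SLOW `g < 1/(2+ρ)`: the `A`-gauge at the LATER time `T^{−n}τ → 0⁻` on the ball of radius `T^{−gn}R` (admissible for large `n` since `g < ½`) gives
  `∫_{B_R}|u(τ)|² ≤ c R^{1−2ρ} T^{n(g(4+2ρ) − 2)} → 0` (`ae_eq_zero_of_gauge_of_slow`);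
* `g < 2/5` with LOCALLY BOUNDED SLICE ENERGY `∫|u(τ)|² ≤ E₀` on some `(α, β)`, `β < 0`: the energies along the orbit are `T^{(5g−2)n}∫|u(τ)|² → 0` on the
  intervals `(Tⁿα, Tⁿβ) → −∞` (`ae_eq_zero_of_gauge_of_slow_of_energyBound`, energy-quiescent past);
* ENDPOINT `ρ = ½` (`½ − ρ/5 = 1/(2+ρ) = 2/5`): every slice has energy `≤ c`, so EVERY discrete clock of rate `g ≠ 2/5` is trivial
  (`ae_eq_zero_of_gauge_half`); the class-rate DSS members (`g = 2/5`) are the registered self-similar/DSS residue.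

These members need not be shape-preserving: the stratum lies in the line's residues T4/T5 and in `stub_nonSelfSimilarRest`'s «DSS about the origin
beyond the wired families».

WHAT THIS IS NOT: not NS, not E — strata of the crux CLASS 19832 on the MODEL lattice, `--supports` stmt-19832; discrete clocks with rate in the window
`[1/(2+ρ), ½ − ρ/5]` of locally unbounded energy, and the class-rate DSS members, stay OPEN. [folklore; line card
`Cruxes/PowerGaugeEulerLiouville/Lines/logtime-breathers.md` T4/T5]
-/

noncomputable section

-- flat `Theorems/<Route><Decl>…` files of one crux share the namespace of the crux (tree convention: `Summit.<S>.<S>.…`)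
set_option linter.dupNamespace false

open MeasureTheory Set Filter Topology Metric Function TopologicalSpace Module
open scoped ENNReal NNReal

namespace Summit.NavierStokesRegularity.NavierStokesRegularity.Theorems.PowerGaugeEulerLiouville

open Literature.Analysis Literature.Analysis.FunctionSpaces Literature.Analysis.FluidPDE

namespace DiscreteClock

variable {u : ℝ → EuclideanSpace ℝ (Fin 3) → EuclideanSpace ℝ (Fin 3)} {p : ℝ → EuclideanSpace ℝ (Fin 3) → ℝ}
  {H : ℝ → EuclideanSpace ℝ (Fin 3) → EuclideanSpace ℝ (Fin 3) →L[ℝ] EuclideanSpace ℝ (Fin 3)} {c : ℝ≥0}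
  {T g : ℝ}

/-! ### Fast discrete clocks -/

/-- **FAST DISCRETE CLOCKS ARE TRIVIAL** (crux hypotheses verbatim — suitable weak Euler pair on the slab, weak gradient, the three power gauges —,
`0 ≤ ρ ≤ ½`; no profile, no regularity): `u(τ, y) = T^{1−g} u(Tτ, T^{g} y)` for all `τ < 0` with `T > 1`, `g > ½ − ρ/5` ⇒ `u = 0` a.e. on `(−∞,0) × ℝ³`
(every slice vanishes on every ball, hence identically; `PastSymmetric.ae_eq_zero_of_gauge_of_pastSlicesZero`).  ⊇ the exact fast power clocks about
`T₀ = 0` (`PastShape.ae_eq_zero_of_gauge_of_pastFastPowerClock`). [folklore] -/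
theorem ae_eq_zero_of_gauge_of_fast {ρ : ℝ} (hρ : 0 ≤ ρ) (hρh : ρ ≤ 1 / 2)
    (hsw : IsSuitableWeakSolutionOn (slab (EuclideanSpace ℝ (Fin 3)) (Iio 0) isOpen_Iio) 0 0 u p)
    (hH : HasWeakSpatialGradientOn (slab (EuclideanSpace ℝ (Fin 3)) (Iio 0) isOpen_Iio) u H)
    (hgauge : ∀ a : ℝ, 0 < a →
      ENNReal.ofReal (a ^ (2 * ρ)) * cknA a (0 : ℝ × EuclideanSpace ℝ (Fin 3)) u +
          ENNReal.ofReal (a ^ ρ) * cknE a (0 : ℝ × EuclideanSpace ℝ (Fin 3)) H +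
        ENNReal.ofReal (a ^ (2 * ρ)) * cknD a (0 : ℝ × EuclideanSpace ℝ (Fin 3)) p ≤ (c : ℝ≥0∞))
    (hT : 1 < T) (hg : 1 / 2 - ρ / 5 < g)
    (h : ∀ τ : ℝ, τ < 0 → ∀ y, u τ y = T ^ (1 - g) • u (T * τ) (T ^ g • y)) :
    uncurry u =ᵐ[volume.restrict (Iio (0 : ℝ) ×ˢ (univ : Set (EuclideanSpace ℝ (Fin 3))))] 0 := by
  have hA : ∀ a : ℝ, 0 < a → ENNReal.ofReal (a ^ (2 * ρ)) *
      cknA a (0 : ℝ × EuclideanSpace ℝ (Fin 3)) u ≤ (c : ℝ≥0∞) :=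
    fun a ha => le_trans (le_trans le_self_add le_self_add) (hgauge a ha)
  refine PastSymmetric.ae_eq_zero_of_gauge_of_pastSlicesZero hρ hsw hH hgauge (T₁ := 0)
    ((ae_restrict_mem measurableSet_Iio).mono fun s hs => ?_)
  exact lintegral_eq_zero_of_forall_ball (fun n => lintegral_ball_slice_eq_zero_of_fast hρ hρh hA hT hg h hs (by positivity))

/-! ### Slow discrete clocks -/

/-- **SLOW DISCRETE CLOCKS ARE TRIVIAL** (crux hypotheses verbatim, `ρ ≥ 0`; no profile, no regularity): `u(τ, y) = T^{1−g} u(Tτ, T^{g} y)` for all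
`τ < 0` with `T > 1`, `g < 1/(2+ρ)` ⇒ `u = 0` a.e.  ⊇ the exact slow power clocks about `T₀ = 0` (`PastShape.ae_eq_zero_of_gauge_of_slowPowerClock`).
[folklore] -/
theorem ae_eq_zero_of_gauge_of_slow {ρ : ℝ} (hρ : 0 ≤ ρ)
    (hsw : IsSuitableWeakSolutionOn (slab (EuclideanSpace ℝ (Fin 3)) (Iio 0) isOpen_Iio) 0 0 u p)
    (hH : HasWeakSpatialGradientOn (slab (EuclideanSpace ℝ (Fin 3)) (Iio 0) isOpen_Iio) u H)
    (hgauge : ∀ a : ℝ, 0 < a →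
      ENNReal.ofReal (a ^ (2 * ρ)) * cknA a (0 : ℝ × EuclideanSpace ℝ (Fin 3)) u +
          ENNReal.ofReal (a ^ ρ) * cknE a (0 : ℝ × EuclideanSpace ℝ (Fin 3)) H +
        ENNReal.ofReal (a ^ (2 * ρ)) * cknD a (0 : ℝ × EuclideanSpace ℝ (Fin 3)) p ≤ (c : ℝ≥0∞))
    (hT : 1 < T) (hg : g < 1 / (2 + ρ))
    (h : ∀ τ : ℝ, τ < 0 → ∀ y, u τ y = T ^ (1 - g) • u (T * τ) (T ^ g • y)) :
    uncurry u =ᵐ[volume.restrict (Iio (0 : ℝ) ×ˢ (univ : Set (EuclideanSpace ℝ (Fin 3))))] 0 := by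
  have hA : ∀ a : ℝ, 0 < a → ENNReal.ofReal (a ^ (2 * ρ)) *
      cknA a (0 : ℝ × EuclideanSpace ℝ (Fin 3)) u ≤ (c : ℝ≥0∞) :=
    fun a ha => le_trans (le_trans le_self_add le_self_add) (hgauge a ha)
  refine PastSymmetric.ae_eq_zero_of_gauge_of_pastSlicesZero hρ hsw hH hgauge (T₁ := 0)
    ((ae_restrict_mem measurableSet_Iio).mono fun s hs => ?_)
  exact lintegral_eq_zero_of_forall_ball (fun n => lintegral_ball_slice_eq_zero_of_slow hρ hA hT hg h hs (by positivity))

/-! ### Discrete clocks with `g < 2/5` and locally bounded energy -/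

/-- **DISCRETE CLOCKS WITH `g < 2/5` AND LOCALLY BOUNDED ENERGY ARE TRIVIAL** (crux hypotheses verbatim, `ρ ≥ 0`; no profile, no regularity):
`u(τ, y) = T^{1−g} u(Tτ, T^{g} y)` for `τ < 0` with `T > 1`, `g < 2/5`, and `∫_{ℝ³}|u(τ)|² ≤ E₀` for `τ` in some interval `(α, β)`, `β < 0` ⇒ `u = 0` a.e.:
the energies along the orbit are `∫|u(Tⁿτ)|² = T^{(5g−2)n}∫|u(τ)|² ≤ T^{(5g−2)n}E₀ → 0` on the intervals `(Tⁿα, Tⁿβ) → −∞`, and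
`ae_eq_zero_of_gauge_of_energyVanishing_allRho` concludes.  ⊇ the exact finite-energy slow clocks (`PowerClock.…finiteEnergySlowClock`, `T₀ = 0`).
[folklore] -/
theorem ae_eq_zero_of_gauge_of_slow_of_energyBound {ρ : ℝ} (hρ : 0 ≤ ρ)
    (hsw : IsSuitableWeakSolutionOn (slab (EuclideanSpace ℝ (Fin 3)) (Iio 0) isOpen_Iio) 0 0 u p)
    (hH : HasWeakSpatialGradientOn (slab (EuclideanSpace ℝ (Fin 3)) (Iio 0) isOpen_Iio) u H)
    (hgauge : ∀ a : ℝ, 0 < a →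
      ENNReal.ofReal (a ^ (2 * ρ)) * cknA a (0 : ℝ × EuclideanSpace ℝ (Fin 3)) u +
          ENNReal.ofReal (a ^ ρ) * cknE a (0 : ℝ × EuclideanSpace ℝ (Fin 3)) H +
        ENNReal.ofReal (a ^ (2 * ρ)) * cknD a (0 : ℝ × EuclideanSpace ℝ (Fin 3)) p ≤ (c : ℝ≥0∞))
    (hT : 1 < T) (hg : g < 2 / 5)
    (h : ∀ τ : ℝ, τ < 0 → ∀ y, u τ y = T ^ (1 - g) • u (T * τ) (T ^ g • y))
    {α β E₀ : ℝ} (hαβ : α < β) (hβ : β < 0)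
    (hE : ∀ τ : ℝ, τ ∈ Ioo α β → ∫⁻ y, ‖u τ y‖ₑ ^ 2 ≤ ENNReal.ofReal E₀) :
    uncurry u =ᵐ[volume.restrict (Iio (0 : ℝ) ×ˢ (univ : Set (EuclideanSpace ℝ (Fin 3))))] 0 := by
  have hT0 : 0 < T := zero_lt_one.trans hT
  have he0 : 5 * g - 2 < 0 := by linarith
  -- energies along the orbit
  have horbit : ∀ n : ℕ, ∀ τ : ℝ, τ < 0 →
      ∫⁻ x, ‖u (T ^ n * τ) x‖ₑ ^ 2 = ENNReal.ofReal (T ^ ((5 * g - 2) * n)) * ∫⁻ y, ‖u τ y‖ₑ ^ 2 := by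
    intro n τ hτ
    have hℓ : 0 < T ^ (g * n) := Real.rpow_pos_of_pos hT0 _
    have hfun : (fun x => ‖u (T ^ n * τ) x‖ₑ ^ 2) =
        fun x => ‖(T ^ ((1 - g) * n))⁻¹ • u τ ((T ^ (g * n))⁻¹ • x)‖ₑ ^ 2 := by
      funext x; rw [slice_earlier hT0 h n hτ x]
    rw [hfun, PowerClock.lintegral_enorm_sq_shape_univ _ hℓ (u τ), clockFactor_inv_eq hT0]
  refine ae_eq_zero_of_gauge_of_energyVanishing_allRho hρ hsw hH hgauge fun ε hε N => ?_
  -- choose `n` with `T^{e n} E₀ < ε` and `Tⁿ β < −N`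
  have h1 : Tendsto (fun n : ℕ => T ^ ((5 * g - 2) * n) * E₀) atTop (𝓝 (0 * E₀)) :=
    (tendsto_rpow_mul_natCast_of_neg hT he0).mul_const _
  rw [zero_mul] at h1
  have h2 : Tendsto (fun n : ℕ => (T : ℝ) ^ n * β) atTop atBot :=
    Filter.Tendsto.atTop_mul_const_of_neg hβ (tendsto_pow_atTop_atTop_of_one_lt hT)
  obtain ⟨n, hn1, hn2⟩ := ((h1.eventually (Iio_mem_nhds hε)).and (h2.eventually (eventually_lt_atBot (-N)))).exists
  have hTn : 0 < (T : ℝ) ^ n := pow_pos hT0 n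
  -- the interval `(Tⁿα, Tⁿβ)` consists of `ε`-quiet times before `−N`
  have hsub : Ioo (T ^ n * α) (T ^ n * β) ⊆ {s : ℝ | s < -N ∧ ∫⁻ x, ‖u s x‖ₑ ^ 2 ≤ ENNReal.ofReal ε} := by
    intro s hs
    obtain ⟨hs1, hs2⟩ := hs
    refine ⟨by linarith, ?_⟩
    set τ : ℝ := (T ^ n)⁻¹ * s with hτ
    have hτ1 : α < τ := by rw [hτ, lt_inv_mul_iff₀ hTn]; exact hs1
    have hτ2 : τ < β := by rw [hτ, inv_mul_lt_iff₀ hTn]; exact hs2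
    have hτ0 : τ < 0 := hτ2.trans hβ
    have hsτ : s = T ^ n * τ := by rw [hτ, mul_inv_cancel_left₀ hTn.ne']
    rw [hsτ, horbit n τ hτ0]
    calc ENNReal.ofReal (T ^ ((5 * g - 2) * n)) * ∫⁻ y, ‖u τ y‖ₑ ^ 2
        ≤ ENNReal.ofReal (T ^ ((5 * g - 2) * n)) * ENNReal.ofReal E₀ := by gcongr; exact hE τ ⟨hτ1, hτ2⟩
      _ = ENNReal.ofReal (T ^ ((5 * g - 2) * n) * E₀) := (ENNReal.ofReal_mul (Real.rpow_nonneg hT0.le _)).symm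
      _ ≤ ENNReal.ofReal ε := ENNReal.ofReal_le_ofReal hn1.le
  have hvol : volume (Ioo (T ^ n * α) (T ^ n * β)) ≠ 0 := by
    rw [Real.volume_Ioo]
    exact (ENNReal.ofReal_pos.2 (by nlinarith)).ne'
  exact fun h0 => hvol (measure_mono_null hsub h0)

/-! ### The endpoint `ρ = ½`: every off-rate discrete clock is trivial -/

/-- **ENDPOINT `ρ = ½`: EVERY DISCRETE CLOCK OF RATE `g ≠ 2/5` IS TRIVIAL** (crux hypotheses verbatim at `ρ = ½`; weak class, no profile, no
regularity): `u(τ, y) = T^{1−g} u(Tτ, T^{g} y)` for `τ < 0` with `T > 1`, `g ≠ 2/5` ⇒ `u = 0` a.e.  (`g > 2/5 = ½ − ρ/5`: `ae_eq_zero_of_gauge_of_fast`;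
`g < 2/5`: every slice has energy `≤ c` by `lintegral_enorm_sq_le_of_gauge_half`, and `ae_eq_zero_of_gauge_of_slow_of_energyBound` on `(−2, −1)`.)
The class rate at the endpoint is exactly `2/5`: only the registered DSS residue survives. [folklore] -/
theorem ae_eq_zero_of_gauge_half
    (hsw : IsSuitableWeakSolutionOn (slab (EuclideanSpace ℝ (Fin 3)) (Iio 0) isOpen_Iio) 0 0 u p)
    (hH : HasWeakSpatialGradientOn (slab (EuclideanSpace ℝ (Fin 3)) (Iio 0) isOpen_Iio) u H)
    (hgauge : ∀ a : ℝ, 0 < a →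
      ENNReal.ofReal (a ^ (2 * (1 / 2 : ℝ))) * cknA a (0 : ℝ × EuclideanSpace ℝ (Fin 3)) u +
          ENNReal.ofReal (a ^ (1 / 2 : ℝ)) * cknE a (0 : ℝ × EuclideanSpace ℝ (Fin 3)) H +
        ENNReal.ofReal (a ^ (2 * (1 / 2 : ℝ))) * cknD a (0 : ℝ × EuclideanSpace ℝ (Fin 3)) p ≤ (c : ℝ≥0∞))
    (hT : 1 < T) (hg : g ≠ 2 / 5)
    (h : ∀ τ : ℝ, τ < 0 → ∀ y, u τ y = T ^ (1 - g) • u (T * τ) (T ^ g • y)) :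
    uncurry u =ᵐ[volume.restrict (Iio (0 : ℝ) ×ˢ (univ : Set (EuclideanSpace ℝ (Fin 3))))] 0 := by
  rcases lt_or_gt_of_ne hg with hlt | hgt
  · have hA : ∀ a : ℝ, 0 < a → ENNReal.ofReal (a ^ (2 * (1 / 2 : ℝ))) *
        cknA a (0 : ℝ × EuclideanSpace ℝ (Fin 3)) u ≤ (c : ℝ≥0∞) :=
      fun a ha => le_trans (le_trans le_self_add le_self_add) (hgauge a ha)
    refine ae_eq_zero_of_gauge_of_slow_of_energyBound (ρ := 1 / 2) (by norm_num) hsw hH hgauge hT hlt h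
      (α := -2) (β := -1) (E₀ := c) (by norm_num) (by norm_num) fun τ hτ => ?_
    have hτ0 : τ < 0 := by linarith [hτ.2]
    have := lintegral_enorm_sq_le_of_gauge_half hA hτ0
    rwa [← ENNReal.ofReal_coe_nnreal] at this
  · exact ae_eq_zero_of_gauge_of_fast (ρ := 1 / 2) (by norm_num) le_rfl hsw hH hgauge hT (by linarith) h

end DiscreteClock

end Summit.NavierStokesRegularity.NavierStokesRegularity.Theorems.PowerGaugeEulerLiouville

end
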